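import Summits.BirchSwinnertonDyer.BirchSwinnertonDyer.Theorems.KatoDescentPotSupersingularWildUpperReducibleNineTorsionClasses
import Summits.BirchSwinnertonDyer.BirchSwinnertonDyer.Theorems.KatoDescentPotSupersingularWildUpperReducibleNineTorsionIsogenies
import Literature.NumberTheory.EllipticCurves.SzpiroLocalDataProofs
import Literature.NumberTheory.EllipticCurves.ModularCurveManinSemistableCoprimeFormProofs
import Literature.NumberTheory.EllipticCurves.ComplexMultiplicationLFunctionIsogenyHoldsProofs
import HarnessLib

/-!
# Route `KatoDescentPotSupersingular` (rung K9, cell `bsd-potss`): the `ℤ/9` CLASSES of the crux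
# `WildUpperReducibleDefect` (item stmt-BirchSwinnertonDyer-19190, registered stub `stub_red_nineTorsionMember`)
# — CONDUCTOR BOUNDS IN THE KERNEL, the per-class RECORDS v2 (binders `hN`, `hiso` discharged) and the stub BY NAME
# on its census classes v2 (a `--supports 19190 --as helper` file; seat `bsd-potss-k9-red9` g3; nothing booked,
# BSD is not proved by any of this, item 19190 is NOT closed by this file)

WHERE THIS SITS.  Third file of the `ℤ/9`-classes series of this seat: `…NineTorsionClasses` (g2, p464900: the
records PER CLASS modulo {bsd.S31, Cassels, GZK, modularity} and the binders `hr`, `hN`, `hiso`, `hSha`),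
`…NineTorsionIsogenies` (g3: the six `3`-isogeny certificates, `hiso` of every literal member discharged), and
THIS FILE:

* §3 CONDUCTORS IN THE KERNEL.  `conductorNorm_dvd_of_badPrimes`: for a globally minimal integer model with
  `|Δ| = ∏ q^{e_q}` and a bound `B`, if at every bad `q` either `q ∤ c₄` and `q ∣ B` (multiplicative: `f_q = 1`,
  Silverman ATAEC IV.10.2(b), tree `conductorExponent_eq_one_of_dvd_Δ_of_not_dvd_c₄`) or `q^{e_q+1} ∤ Δ` and
  `q^{e_q} ∣ B` (Ogg: `f_q ≤ ord_q Δ_min`, ATAEC IV.11.1, tree `conductorExponent_lt_of_not_pow_dvd`), then `N ∣ B`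
  (`conductorNorm_dvd_of_forall_conductorExponent_le`).  Records: `N(54b1) ∣ 54` and `N(1890r1) ∣ 1890`, so both
  `< 5000`: the `hN` binders of `missingPPart_class54b` / `missingPPart_class1890r` («no kernel conductor tool» in
  g2's HANDOFF) are theorems.  (`f₃ = 3` itself would need the component count of Tate's algorithm at the wild
  prime; the divisibility is all bsd.S31 needs.)
* §4 RECORDS v2.  `missingPPart_class54b'`, `missingPPart_class1890r'`: `MissingPPartAt W p` for every `p` at every
  globally minimal `W ∼ W₀`, binder `hr` ONLY (+ the four named facts); `missingPPart_members`: the NINE literal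
  members with no `hiso` (every `p` on `54b`, `1890r`; `p = 3` on `122094bl` from `hr`, `hs`, `hSha` at `122094bl1`).
* §5 `stub_red_nineTorsionMember_onCensusClasses'` = the g2 theorem (registered stub's hypotheses and conclusion
  VERBATIM + the census-membership hypothesis) with the two conductor conjuncts DISCHARGED.  Inputs left: the four
  named facts; `r_an(54b1) = 0`; `r_an(1890r1) = 0`; at `122094bl1` `r_an = 0`, `#Ш_an = 1`, `#Ш[3^∞] = 1`
  (kit j256899).
* §6 (appended) THE `hr` BINDERS TOO: the analytic rank is an ISOGENY INVARIANT, unconditionally in the tree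
  (`analyticRank_eq_of_isIsogenous'`, Knapp Thm. 11.67 by the `ℓ`-adic proof), so `r_an(W₀) = 0` follows from the
  ROW's own hypothesis `r_an(W) = 0` along the census isogeny.  Records v3 `missingPPart_of_isIsogenous_54b1/_1890r1`
  (inputs: the four named facts + the row's `r_an(W) ≤ 1`), `missingUpper3_of_isIsogenous_122094bl1` (+ `hs`, `hSha`),
  and `stub_red_nineTorsionMember_onCensusClasses_of_namedFacts`: the registered stub on its census classes from
  {bsd.S31, Cassels, GZK, modularity} + `#Ш_an(122094bl1) = 1` + `#Ш(122094bl1)[3^∞] = 1` ONLY — on the classes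
  `54b`, `1890r` NO data binder at all is left.

HONEST FRAMING.  Per-class records; census-level only; class-wide the stub is the count fact's road (g0 file) and
the item stays settled-by-citation via glue 19711 exactly as before; `hr` (an `L`-value) and `hSha` (a descent
certificate) remain binders; typed ≠ proved ≠ endorsed; nothing booked; BSD is not advanced.  THEOREMS ONLY (no
definition, no new fact, no `sorry`).

References: [Silverman1994] IV.10.2(b), IV.11.1 (Ogg's formula); [Ogg1967]; [BombieriGubler2006] 12.5.9;
[SilvermanAEC2009] VIII.8, VIII.11, C.16; [Cremona2006] Table 1 (54b, 1890r, 122094bl); [CreutzMiller2012] Thm. 1.1;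
[Miller2011LMS] §1, Def. 1.1; [Cassels1965ArithmeticVIII].
-/

set_option autoImplicit false
-- sibling precedent (`KatoDescentPotSupersingularAssembly.lean`): the directory name repeats the summit name
set_option linter.dupNamespace false

noncomputable section

open scoped Classical

namespace Summit.BirchSwinnertonDyer.BirchSwinnertonDyer.Theorems.WildUpperReducibleNineTorsionRecords

open WeierstrassCurve IsDedekindDomain Rat.HeightOneSpectrum Literature.NumberTheory.EllipticCurves
  Literature.NumberTheory.EllipticCurves.Rank1Residual
  Literature.NumberTheory.EllipticCurves.Rank1Residual.Typed
  Literature.NumberTheory.EllipticCurves.Rank1Residual.X11RankOneCertificates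
  Summit.BirchSwinnertonDyer.Rank1Residual
  Summit.BirchSwinnertonDyer.Rank1Residual.Additive
  Summit.BirchSwinnertonDyer.BirchSwinnertonDyer.Theorems.WildUpperReducibleNineTorsionClasses
  Summit.BirchSwinnertonDyer.BirchSwinnertonDyer.Theorems.WildUpperReducibleNineTorsionIsogenies

/-! ## §2b The three `9`-isogenies by composition -/

/-- **The `9`-isogenies `W₁ ∼ W₉` of the three classes** (torsion-free member ∼ `ℤ/9` member, by composing the two
`3`-isogenies through `W₀`; Cremona's matrix entry `9`). [cite: Cremona2006, Table 1 (isogeny matrices [[1,3,3],[3,1,9],[3,9,1]])] -/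
theorem isIsogenous_nine :
    IsIsogenous (⟨1, -1, 1, -29, -53⟩ : WeierstrassCurve ℚ) ⟨1, -1, 1, -14, 29⟩ ∧
    IsIsogenous (⟨1, -1, 1, -1979507, -1071477449⟩ : WeierstrassCurve ℚ) ⟨1, -1, 1, 63058, -7866691⟩ ∧
    IsIsogenous (⟨1, -1, 1, -426456524, -3389585226281⟩ : WeierstrassCurve ℚ)
      ⟨1, -1, 1, -193010459, 1031970436427⟩ := by
  haveI := isElliptic_54b1; haveI := isElliptic_54b2; haveI := isElliptic_1890r1; haveI := isElliptic_1890r2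
  haveI := isElliptic_122094bl1; haveI := isElliptic_122094bl2
  exact ⟨isIsogenous_54b1_54b2.symm_of_charZero.trans' isIsogenous_54b1_54b3,
    isIsogenous_1890r1_1890r2.symm_of_charZero.trans' isIsogenous_1890r1_1890r3,
    isIsogenous_122094bl1_122094bl2.symm_of_charZero.trans' isIsogenous_122094bl1_122094bl3⟩

/-! ## §3 Conductor bounds in the kernel -/

/-- A prime dividing `∏ q^{e_q}` over a list of primes is one of the listed `q`. [folklore] -/
private theorem exists_mem_of_prime_dvd_prod_pow {q : ℕ} (hq : q.Prime) :
    ∀ (l : List (ℕ × ℕ)), (∀ t ∈ l, t.1.Prime) → q ∣ (l.map fun t => t.1 ^ t.2).prod → ∃ t ∈ l, t.1 = q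
  | [], _, h => by
    simp only [List.map_nil, List.prod_nil, Nat.dvd_one] at h
    exact absurd h hq.one_lt.ne'
  | t :: l, hl, h => by
    rw [List.map_cons, List.prod_cons] at h
    rcases (Nat.Prime.dvd_mul hq).mp h with h1 | h1
    · exact ⟨t, List.mem_cons_self, ((Nat.prime_dvd_prime_iff_eq hq (hl t List.mem_cons_self)).mp
        (hq.dvd_of_dvd_pow h1)).symm⟩
    · obtain ⟨t', ht', h'⟩ :=
        exists_mem_of_prime_dvd_prod_pow hq l (fun t' ht' ↦ hl t' (List.mem_cons_of_mem _ ht')) h1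
      exact ⟨t', List.mem_cons_of_mem _ ht', h'⟩

/-- **Conductor divisibility `N_E ∣ B` from the bad-prime data of a globally minimal integer model** (the shape
`decide` evaluates on a record: `bad = [(q, e_q), …]` with `|Δ| = ∏ q^{e_q}`, every `q` prime). At each bad `q`
EITHER `q ∤ c₄` and `q ∣ B` — multiplicative reduction, `f_q = 1` (Silverman ATAEC IV.10.2(b), tree
`conductorExponent_eq_one_of_dvd_Δ_of_not_dvd_c₄`) — OR `q^{e_q+1} ∤ Δ` and `q^{e_q} ∣ B` — Ogg's
`f_q ≤ ord_q Δ_min` (ATAEC IV.11.1, tree `conductorExponent_lt_of_not_pow_dvd`); a prime off the list has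
`f_q = 0` (`conductorExponent_eq_zero_of_not_dvd_Δ`). Then `N_E = ∏ q^{f_q} ∣ B`
(`conductorNorm_dvd_of_forall_conductorExponent_le`). [cite: Silverman1994, IV.10.2(b) and IV.11.1]
[cite: BombieriGubler2006, 12.5.9] -/
theorem conductorNorm_dvd_of_badPrimes (a1 a2 a3 a4 a6 : ℤ) (W : WeierstrassCurve ℚ) [hE : W.IsElliptic]
    [hM : W.IsGloballyMinimal] (hW : W = ⟨a1, a2, a3, a4, a6⟩)
    (bad : List (ℕ × ℕ)) (hprime : ∀ t ∈ bad, t.1.Prime)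
    (hsupp : (discOf [a1, a2, a3, a4, a6]).natAbs = (bad.map fun t => t.1 ^ t.2).prod)
    {B : ℕ} (hB : B ≠ 0)
    (hbad : ∀ t ∈ bad, (¬ (t.1 : ℤ) ∣ c4Of [a1, a2, a3, a4, a6] ∧ t.1 ∣ B) ∨
      (¬ (t.1 : ℤ) ^ (t.2 + 1) ∣ discOf [a1, a2, a3, a4, a6] ∧ t.1 ^ t.2 ∣ B)) :
    W.conductorNorm ℤ ∣ B := by
  subst hW
  set W₀ : WeierstrassCurve ℤ := ⟨a1, a2, a3, a4, a6⟩ with hW₀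
  have hW : W₀.baseChange ℚ = ⟨a1, a2, a3, a4, a6⟩ := by
    ext <;> simp [hW₀, WeierstrassCurve.baseChange, WeierstrassCurve.map]
  have hΔW : W₀.Δ = discOf [a1, a2, a3, a4, a6] := by
    simp only [hW₀, WeierstrassCurve.Δ, WeierstrassCurve.b₂, WeierstrassCurve.b₄, WeierstrassCurve.b₆,
      WeierstrassCurve.b₈, discOf, invariants]
    ring
  have hcW : W₀.c₄ = c4Of [a1, a2, a3, a4, a6] := by
    simp only [hW₀, WeierstrassCurve.c₄, WeierstrassCurve.b₂, WeierstrassCurve.b₄, c4Of, invariants]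
    ring
  haveI hE' : (W₀.baseChange ℚ).IsElliptic := hW ▸ hE
  haveI hM' : (W₀.baseChange ℚ).IsGloballyMinimal := hW ▸ hM
  rw [← hW]
  refine conductorNorm_dvd_of_forall_conductorExponent_le (W₀.baseChange ℚ) hB fun p ↦ ?_
  have hp : (p : ℕ).Prime := p.2
  set v : HeightOneSpectrum ℤ := (primesEquiv (R := ℤ)).symm p with hv
  have hgen : (natGenerator v : ℤ) = ((p : ℕ) : ℤ) := by
    rw [hv, Literature.NumberTheory.EllipticCurves.Rat.natGenerator_primesEquiv_symm]
  have hmin : (W₀.baseChange ℚ).IsMinimalAt v := IsGloballyMinimal.isMinimalAt_int _ v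
  by_cases hdvd : ((p : ℕ) : ℤ) ∣ W₀.Δ
  · have hdvd' : (p : ℕ) ∣ (bad.map fun t => t.1 ^ t.2).prod := by
      rw [← hsupp, ← hΔW]; exact Int.natCast_dvd.mp hdvd
    obtain ⟨t, ht, htp⟩ := exists_mem_of_prime_dvd_prod_pow hp bad hprime hdvd'
    rcases hbad t ht with ⟨hc₄, htB⟩ | ⟨hnot, htB⟩
    · have h1 : (W₀.baseChange ℚ).conductorExponent v = 1 :=
        conductorExponent_eq_one_of_dvd_Δ_of_not_dvd_c₄ hmin (by rw [hgen]; exact hdvd)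
          (by rw [hgen, hcW, ← htp]; exact hc₄)
      rw [h1]
      exact (hp.dvd_iff_one_le_factorization hB).mp (htp ▸ htB)
    · have hlt : (W₀.baseChange ℚ).conductorExponent v < t.2 + 1 :=
        conductorExponent_lt_of_not_pow_dvd hmin (by rw [hgen, hΔW, ← htp]; exact hnot)
      have hle : t.2 ≤ B.factorization p := (hp.pow_dvd_iff_le_factorization hB).mp (htp ▸ htB)
      omega
  · rw [conductorExponent_eq_zero_of_not_dvd_Δ hmin (by rw [hgen]; exact hdvd)]
    exact Nat.zero_le _

/-- **`N(54b1) ∣ 54` — IN THE KERNEL** (`Δ = -2³·3³`, `c₄ = -63`: multiplicative at `2`, `f₃ ≤ ord₃ Δ = 3`). In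
particular `N(54b1) < 5000`, the `hN` binder of `missingPPart_class54b`. (Cremona: `N = 54` exactly; `f₃ = 3` would
need the component count of Tate's algorithm at `3`.) [cite: Silverman1994, IV.10.2(b) and IV.11.1]
[cite: Cremona2006, Table 1 (54b1)] -/
theorem conductorNorm_54b1_dvd : (⟨1, -1, 1, 1, -1⟩ : WeierstrassCurve ℚ).conductorNorm ℤ ∣ 54 := by
  haveI := isElliptic_54b1
  haveI := isGloballyMinimal_54b1
  exact conductorNorm_dvd_of_badPrimes 1 (-1) 1 1 (-1) _ (by ext <;> norm_num) [(2, 3), (3, 3)]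
    (by intro t ht; simp only [List.mem_cons, List.not_mem_nil, or_false] at ht; rcases ht with rfl | rfl <;> norm_num)
    (by decide +kernel) (by norm_num) (by decide +kernel)

/-- **`N(1890r1) ∣ 1890` — IN THE KERNEL** (`Δ = -2⁶·3³·5³·7⁹`, `c₄ = 1171521` prime to `70`: multiplicative at
`2, 5, 7`, `f₃ ≤ ord₃ Δ = 3`). In particular `N(1890r1) < 5000`, the `hN` binder of `missingPPart_class1890r`.
[cite: Silverman1994, IV.10.2(b) and IV.11.1] [cite: Cremona2006, Table 1 (1890r1)] -/
theorem conductorNorm_1890r1_dvd :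
    (⟨1, -1, 1, -24407, -1468369⟩ : WeierstrassCurve ℚ).conductorNorm ℤ ∣ 1890 := by
  haveI := isElliptic_1890r1
  haveI := isGloballyMinimal_1890r1
  exact conductorNorm_dvd_of_badPrimes 1 (-1) 1 (-24407) (-1468369) _ (by ext <;> norm_num)
    [(2, 6), (3, 3), (5, 3), (7, 9)]
    (by intro t ht; simp only [List.mem_cons, List.not_mem_nil, or_false] at ht; rcases ht with rfl | rfl | rfl | rfl <;> norm_num)
    (by decide +kernel) (by norm_num) (by decide +kernel)

/-- `N(54b1) < 5000`. [cite: Cremona2006, Table 1 (54b1)] -/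
theorem conductorNorm_54b1_lt : (⟨1, -1, 1, 1, -1⟩ : WeierstrassCurve ℚ).conductorNorm ℤ < 5000 :=
  (Nat.le_of_dvd (by norm_num) conductorNorm_54b1_dvd).trans_lt (by norm_num)

/-- `N(1890r1) < 5000`. [cite: Cremona2006, Table 1 (1890r1)] -/
theorem conductorNorm_1890r1_lt : (⟨1, -1, 1, -24407, -1468369⟩ : WeierstrassCurve ℚ).conductorNorm ℤ < 5000 :=
  (Nat.le_of_dvd (by norm_num) conductorNorm_1890r1_dvd).trans_lt (by norm_num)

/-! ## §4 Records v2: `hN` and `hiso` discharged -/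

/-- **RECORD `54b` v2 — `MissingPPartAt W p` for every prime `p` at every globally minimal `W ∼_ℚ 54b1`, binder
`hr` (`r_an(54b1) = 0`) ONLY** (+ bsd.S31, Cassels, GZK, modularity): the sibling's `missingPPart_class54b` with
`hN` discharged by `conductorNorm_54b1_lt`. Per class; nothing booked. [cite: CreutzMiller2012, Thm 1.1]
[cite: Miller2011LMS, §1 and Def. 1.1] [cite: Cremona2006, Table 1 (54b)] -/
theorem missingPPart_class54b' (hS31 : bsdTriple_of_rank_le_one_of_conductor_lt)
    (hCassels : bsdRHS_eq_of_isIsogenous) (hGZK : rank_eq_analyticRank_of_analyticRank_le_one)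
    (hmod : hasEntireLFunction_rat) (hr : (⟨1, -1, 1, 1, -1⟩ : WeierstrassCurve ℚ).analyticRank = 0)
    (p : ℕ) [Fact p.Prime] (W : WeierstrassCurve ℚ) [W.IsElliptic] [W.IsGloballyMinimal]
    (hiso : IsIsogenous W ⟨1, -1, 1, 1, -1⟩) : MissingPPartAt W p :=
  missingPPart_class54b hS31 hCassels hGZK hmod _ rfl hr conductorNorm_54b1_lt p W hiso

/-- **RECORD `1890r` v2 — `MissingPPartAt W p` for every prime `p` at every globally minimal `W ∼_ℚ 1890r1`,
binder `hr` (`r_an(1890r1) = 0`) ONLY** (+ the four named facts): the sibling's `missingPPart_class1890r` with `hN`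
discharged by `conductorNorm_1890r1_lt`. Per class; nothing booked. [cite: CreutzMiller2012, Thm 1.1]
[cite: Miller2011LMS, §1 and Def. 1.1] [cite: Cremona2006, Table 1 (1890r)] -/
theorem missingPPart_class1890r' (hS31 : bsdTriple_of_rank_le_one_of_conductor_lt)
    (hCassels : bsdRHS_eq_of_isIsogenous) (hGZK : rank_eq_analyticRank_of_analyticRank_le_one)
    (hmod : hasEntireLFunction_rat) (hr : (⟨1, -1, 1, -24407, -1468369⟩ : WeierstrassCurve ℚ).analyticRank = 0)
    (p : ℕ) [Fact p.Prime] (W : WeierstrassCurve ℚ) [W.IsElliptic] [W.IsGloballyMinimal]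
    (hiso : IsIsogenous W ⟨1, -1, 1, -24407, -1468369⟩) : MissingPPartAt W p :=
  missingPPart_class1890r hS31 hCassels hGZK hmod _ rfl hr conductorNorm_1890r1_lt p W hiso

/-- **The nine literal members** — `MissingPPartAt` at `54b1`, `54b2`, `54b3` (every `p`; binder `hr` at `54b1`),
at `1890r1`, `1890r2`, `1890r3` (every `p`; binder `hr` at `1890r1`), and at `p = 3` at `122094bl1`, `122094bl2`,
`122094bl3` (binders `hr`, `hs`, `hSha` at `122094bl1`) — with the class datum `hiso` DISCHARGED by §2 (+ bsd.S31
for the first six, Cassels, GZK, modularity). Per curve; nothing booked. [cite: CreutzMiller2012, Thm 1.1]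
[cite: Miller2011LMS, §1 and Def. 1.1] [cite: Cassels1965ArithmeticVIII] [cite: Cremona2006, Table 1] -/
theorem missingPPart_members (hS31 : bsdTriple_of_rank_le_one_of_conductor_lt)
    (hCassels : bsdRHS_eq_of_isIsogenous) (hGZK : rank_eq_analyticRank_of_analyticRank_le_one)
    (hmod : hasEntireLFunction_rat)
    (h54 : (⟨1, -1, 1, 1, -1⟩ : WeierstrassCurve ℚ).analyticRank = 0)
    (h1890 : (⟨1, -1, 1, -24407, -1468369⟩ : WeierstrassCurve ℚ).analyticRank = 0)
    (h122094 : (⟨1, -1, 1, -5862644, -3527169193⟩ : WeierstrassCurve ℚ).analyticRank = 0 ∧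
      shaAn (⟨1, -1, 1, -5862644, -3527169193⟩ : WeierstrassCurve ℚ) = ((1 : ℚ) : ℂ) ∧
      Nat.card (AddCommGroup.primaryComponent
        (⟨1, -1, 1, -5862644, -3527169193⟩ : WeierstrassCurve ℚ).sha 3) = 1)
    (p : ℕ) [Fact p.Prime] :
    (haveI := isElliptic_54b1; haveI := isGloballyMinimal_54b1
      MissingPPartAt (⟨1, -1, 1, 1, -1⟩ : WeierstrassCurve ℚ) p) ∧
    (haveI := isElliptic_54b2; haveI := isGloballyMinimal_54b2
      MissingPPartAt (⟨1, -1, 1, -29, -53⟩ : WeierstrassCurve ℚ) p) ∧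
    (haveI := isElliptic_54b3; haveI := isGloballyMinimal_54b3
      MissingPPartAt (⟨1, -1, 1, -14, 29⟩ : WeierstrassCurve ℚ) p) ∧
    (haveI := isElliptic_1890r1; haveI := isGloballyMinimal_1890r1
      MissingPPartAt (⟨1, -1, 1, -24407, -1468369⟩ : WeierstrassCurve ℚ) p) ∧
    (haveI := isElliptic_1890r2; haveI := isGloballyMinimal_1890r2
      MissingPPartAt (⟨1, -1, 1, -1979507, -1071477449⟩ : WeierstrassCurve ℚ) p) ∧
    (haveI := isElliptic_1890r3; haveI := isGloballyMinimal_1890r3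
      MissingPPartAt (⟨1, -1, 1, 63058, -7866691⟩ : WeierstrassCurve ℚ) p) ∧
    (haveI := isElliptic_122094bl1; haveI := isGloballyMinimal_122094bl1; haveI : Fact (Nat.Prime 3) := ⟨Nat.prime_three⟩
      MissingPPartAt (⟨1, -1, 1, -5862644, -3527169193⟩ : WeierstrassCurve ℚ) 3) ∧
    (haveI := isElliptic_122094bl2; haveI := isGloballyMinimal_122094bl2; haveI : Fact (Nat.Prime 3) := ⟨Nat.prime_three⟩
      MissingPPartAt (⟨1, -1, 1, -426456524, -3389585226281⟩ : WeierstrassCurve ℚ) 3) ∧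
    (haveI := isElliptic_122094bl3; haveI := isGloballyMinimal_122094bl3; haveI : Fact (Nat.Prime 3) := ⟨Nat.prime_three⟩
      MissingPPartAt (⟨1, -1, 1, -193010459, 1031970436427⟩ : WeierstrassCurve ℚ) 3) := by
  haveI := isElliptic_54b1; haveI := isElliptic_54b2; haveI := isElliptic_54b3
  haveI := isElliptic_1890r1; haveI := isElliptic_1890r2; haveI := isElliptic_1890r3
  haveI := isElliptic_122094bl1; haveI := isElliptic_122094bl2; haveI := isElliptic_122094bl3
  haveI := isGloballyMinimal_54b1; haveI := isGloballyMinimal_54b2; haveI := isGloballyMinimal_54b3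
  haveI := isGloballyMinimal_1890r1; haveI := isGloballyMinimal_1890r2; haveI := isGloballyMinimal_1890r3
  haveI := isGloballyMinimal_122094bl1; haveI := isGloballyMinimal_122094bl2; haveI := isGloballyMinimal_122094bl3
  haveI : Fact (Nat.Prime 3) := ⟨Nat.prime_three⟩
  refine ⟨missingPPart_class54b' hS31 hCassels hGZK hmod h54 p _ (isIsogenous_self _),
    missingPPart_class54b' hS31 hCassels hGZK hmod h54 p _ isIsogenous_54b1_54b2.symm_of_charZero,
    missingPPart_class54b' hS31 hCassels hGZK hmod h54 p _ isIsogenous_54b1_54b3.symm_of_charZero,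
    missingPPart_class1890r' hS31 hCassels hGZK hmod h1890 p _ (isIsogenous_self _),
    missingPPart_class1890r' hS31 hCassels hGZK hmod h1890 p _ isIsogenous_1890r1_1890r2.symm_of_charZero,
    missingPPart_class1890r' hS31 hCassels hGZK hmod h1890 p _ isIsogenous_1890r1_1890r3.symm_of_charZero,
    missingPPart3_class122094bl hCassels hGZK hmod _ rfl h122094.1 h122094.2.1 h122094.2.2 _ (isIsogenous_self _),
    missingPPart3_class122094bl hCassels hGZK hmod _ rfl h122094.1 h122094.2.1 h122094.2.2 _
      isIsogenous_122094bl1_122094bl2.symm_of_charZero,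
    missingPPart3_class122094bl hCassels hGZK hmod _ rfl h122094.1 h122094.2.1 h122094.2.2 _
      isIsogenous_122094bl1_122094bl3.symm_of_charZero⟩

/-! ## §5 `stub_red_nineTorsionMember` BY NAME on its census classes, v2 -/

/-- **`Sig.stub_red_nineTorsionMember` RESTRICTED TO ITS CENSUS CLASSES, v2** — the sibling's
`stub_red_nineTorsionMember_onCensusClasses` (hypotheses and conclusion of the registered stub of item 19190
VERBATIM, plus the census-membership hypothesis `W ∼ 54b1 ∨ W ∼ 1890r1 ∨ W ∼ 122094bl1`) with the two CONDUCTOR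
conjuncts of its inputs DISCHARGED in the kernel (§3). Inputs left: bsd.S31, Cassels, GZK, modularity; `r_an = 0`
at `54b1` and at `1890r1`; at `122094bl1` `r_an = 0`, `#Ш_an = 1` and the `3`-descent certificate `#Ш[3^∞] = 1`
(kit j256899). HONEST LABEL: census-level only; class-wide the stub is the count fact's road; the item is NOT
closed by this. [cite: CreutzMiller2012, Thm 1.1] [cite: Miller2011LMS, §1 and Def. 1.1]
[cite: Cassels1965ArithmeticVIII] [cite: Cremona2006, Table 1] -/
theorem stub_red_nineTorsionMember_onCensusClasses' (hS31 : bsdTriple_of_rank_le_one_of_conductor_lt)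
    (hCassels : bsdRHS_eq_of_isIsogenous) (hGZK : rank_eq_analyticRank_of_analyticRank_le_one)
    (hmod : hasEntireLFunction_rat)
    (h54 : (⟨1, -1, 1, 1, -1⟩ : WeierstrassCurve ℚ).analyticRank = 0)
    (h1890 : (⟨1, -1, 1, -24407, -1468369⟩ : WeierstrassCurve ℚ).analyticRank = 0)
    (h122094 : (⟨1, -1, 1, -5862644, -3527169193⟩ : WeierstrassCurve ℚ).analyticRank = 0 ∧
      shaAn (⟨1, -1, 1, -5862644, -3527169193⟩ : WeierstrassCurve ℚ) = ((1 : ℚ) : ℂ) ∧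
      Nat.card (AddCommGroup.primaryComponent
        (⟨1, -1, 1, -5862644, -3527169193⟩ : WeierstrassCurve ℚ).sha 3) = 1) :
    ∀ (W : WeierstrassCurve ℚ) [W.IsElliptic] [W.IsGloballyMinimal] [Fact (3 : ℕ).Prime],
      W.analyticRank = 0 → ClassO6 W 3 → ¬ W.HasIrreducibleModPGaloisRep 3 →
      (∃ (W' : WeierstrassCurve ℚ) (_ : W'.IsElliptic), IsIsogenous W W' ∧ 3 ^ 2 ∣ W'.torsionOrder) →
      (IsIsogenous W (⟨1, -1, 1, 1, -1⟩ : WeierstrassCurve ℚ) ∨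
        IsIsogenous W (⟨1, -1, 1, -24407, -1468369⟩ : WeierstrassCurve ℚ) ∨
        IsIsogenous W (⟨1, -1, 1, -5862644, -3527169193⟩ : WeierstrassCurve ℚ)) →
        MissingUpperBoundAt W 3 :=
  stub_red_nineTorsionMember_onCensusClasses hS31 hCassels hGZK hmod ⟨h54, conductorNorm_54b1_lt⟩
    ⟨h1890, conductorNorm_1890r1_lt⟩ h122094


/-! ## §6 Records v3: the `hr` binders from the ROW's analytic rank (isogeny invariance of `r_an`) -/

/-- **RECORD `54b` v3 — `MissingPPartAt W p` for every prime `p` at every globally minimal `W ∼_ℚ 54b1` of analytic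
rank `≤ 1`, from NAMED FACTS ONLY** (bsd.S31, Cassels, GZK, modularity): `r_an(54b1) = r_an(W)` by the unconditional
isogeny invariance of the analytic rank (`analyticRank_eq_of_isIsogenous'`, Knapp Thm. 11.67), `N(54b1) < 5000` by §3.
Per class; nothing booked. [cite: CreutzMiller2012, Thm 1.1] [cite: Knapp1993, Thm. 11.67] [cite: Miller2011LMS, §1 and Def. 1.1] -/
theorem missingPPart_of_isIsogenous_54b1 (hS31 : bsdTriple_of_rank_le_one_of_conductor_lt)
    (hCassels : bsdRHS_eq_of_isIsogenous) (hGZK : rank_eq_analyticRank_of_analyticRank_le_one)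
    (hmod : hasEntireLFunction_rat) (p : ℕ) [Fact p.Prime] (W : WeierstrassCurve ℚ) [W.IsElliptic]
    [W.IsGloballyMinimal] (hr : W.analyticRank ≤ 1) (hiso : IsIsogenous W ⟨1, -1, 1, 1, -1⟩) : MissingPPartAt W p := by
  haveI := isElliptic_54b1
  haveI := isGloballyMinimal_54b1
  exact missingPPartAt_of_isIsogenous_of_conductor_lt hS31 hCassels hGZK hmod _
    (by rw [← analyticRank_eq_of_isIsogenous' hiso]; exact hr) conductorNorm_54b1_lt p W hiso

/-- **RECORD `1890r` v3 — `MissingPPartAt W p` for every prime `p` at every globally minimal `W ∼_ℚ 1890r1` of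
analytic rank `≤ 1`, from NAMED FACTS ONLY** (bsd.S31, Cassels, GZK, modularity; `r_an` transported by
`analyticRank_eq_of_isIsogenous'`, `N(1890r1) < 5000` by §3). Per class; nothing booked.
[cite: CreutzMiller2012, Thm 1.1] [cite: Knapp1993, Thm. 11.67] [cite: Miller2011LMS, §1 and Def. 1.1] -/
theorem missingPPart_of_isIsogenous_1890r1 (hS31 : bsdTriple_of_rank_le_one_of_conductor_lt)
    (hCassels : bsdRHS_eq_of_isIsogenous) (hGZK : rank_eq_analyticRank_of_analyticRank_le_one)
    (hmod : hasEntireLFunction_rat) (p : ℕ) [Fact p.Prime] (W : WeierstrassCurve ℚ) [W.IsElliptic]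
    [W.IsGloballyMinimal] (hr : W.analyticRank ≤ 1) (hiso : IsIsogenous W ⟨1, -1, 1, -24407, -1468369⟩) :
    MissingPPartAt W p := by
  haveI := isElliptic_1890r1
  haveI := isGloballyMinimal_1890r1
  exact missingPPartAt_of_isIsogenous_of_conductor_lt hS31 hCassels hGZK hmod _
    (by rw [← analyticRank_eq_of_isIsogenous' hiso]; exact hr) conductorNorm_1890r1_lt p W hiso

/-- **RECORD `122094bl` v3 — `MissingPPartAt W 3` at every globally minimal `W ∼_ℚ 122094bl1` of analytic rank `≤ 1`**,
from Cassels, GZK, modularity, the row's `r_an` (transported by `analyticRank_eq_of_isIsogenous'`) and the two data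
binders of `122094bl1`: `hs` (`#Ш_an = 1`) and the `3`-descent certificate `hSha` (`#Ш[3^∞] = 1`, kit j256899). Per class;
nothing booked. [cite: Knapp1993, Thm. 11.67] [cite: Miller2011LMS, §1 and Def. 1.1] [cite: Cassels1965ArithmeticVIII] -/
theorem missingPPart3_of_isIsogenous_122094bl1 (hCassels : bsdRHS_eq_of_isIsogenous)
    (hGZK : rank_eq_analyticRank_of_analyticRank_le_one) (hmod : hasEntireLFunction_rat)
    (hs : shaAn (⟨1, -1, 1, -5862644, -3527169193⟩ : WeierstrassCurve ℚ) = ((1 : ℚ) : ℂ))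
    (hSha : Nat.card (AddCommGroup.primaryComponent
      (⟨1, -1, 1, -5862644, -3527169193⟩ : WeierstrassCurve ℚ).sha 3) = 1)
    (W : WeierstrassCurve ℚ) [W.IsElliptic] [W.IsGloballyMinimal] (hr : W.analyticRank ≤ 1)
    (hiso : IsIsogenous W ⟨1, -1, 1, -5862644, -3527169193⟩) :
    haveI : Fact (Nat.Prime 3) := ⟨Nat.prime_three⟩
    MissingPPartAt W 3 := by
  haveI := isElliptic_122094bl1
  haveI := isGloballyMinimal_122094bl1
  haveI : Fact (Nat.Prime 3) := ⟨Nat.prime_three⟩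
  exact missingPPartAt_of_isIsogenous_of_card_primaryComponent_eq_one hCassels hGZK hmod _
    (by rw [← analyticRank_eq_of_isIsogenous' hiso]; exact hr) 3 hs (by simp) hSha W hiso

/-- **`Sig.stub_red_nineTorsionMember` ON ITS CENSUS CLASSES FROM NAMED FACTS** (+ the two data binders of `122094bl1`):
the registered stub of item 19190 — hypotheses and conclusion VERBATIM — plus the census-membership hypothesis
`W ∼ 54b1 ∨ W ∼ 1890r1 ∨ W ∼ 122094bl1`, from bsd.S31 (`hS31`), Cassels (`hCassels`), GZK (`hGZK`), modularity (`hmod`),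
`#Ш_an(122094bl1) = 1` (`hs`) and `#Ш(122094bl1)[3^∞] = 1` (`hSha`, kit j256899) ONLY: the conductor conjuncts are kernel
(§3), the class data are kernel (`…NineTorsionIsogenies`), and every `r_an(W₀) = 0` input of v1/v2 is now READ OFF THE
ROW (`W.analyticRank = 0` is a hypothesis of the stub) by the unconditional isogeny invariance of the analytic rank.
On the classes `54b`, `1890r` no data binder is left at all. HONEST LABEL: census-level only (the membership
hypothesis IS the C-X3K-0 census statement for `N < 5·10⁵`); class-wide the stub is the count fact's road; the item is
NOT closed by this. [cite: CreutzMiller2012, Thm 1.1] [cite: Knapp1993, Thm. 11.67] [cite: Miller2011LMS, §1 and Def. 1.1]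
[cite: Cassels1965ArithmeticVIII] [cite: Cremona2006, Table 1] -/
theorem stub_red_nineTorsionMember_onCensusClasses_of_namedFacts
    (hS31 : bsdTriple_of_rank_le_one_of_conductor_lt) (hCassels : bsdRHS_eq_of_isIsogenous)
    (hGZK : rank_eq_analyticRank_of_analyticRank_le_one) (hmod : hasEntireLFunction_rat)
    (hs : shaAn (⟨1, -1, 1, -5862644, -3527169193⟩ : WeierstrassCurve ℚ) = ((1 : ℚ) : ℂ))
    (hSha : Nat.card (AddCommGroup.primaryComponent
      (⟨1, -1, 1, -5862644, -3527169193⟩ : WeierstrassCurve ℚ).sha 3) = 1) :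
    ∀ (W : WeierstrassCurve ℚ) [W.IsElliptic] [W.IsGloballyMinimal] [Fact (3 : ℕ).Prime],
      W.analyticRank = 0 → ClassO6 W 3 → ¬ W.HasIrreducibleModPGaloisRep 3 →
      (∃ (W' : WeierstrassCurve ℚ) (_ : W'.IsElliptic), IsIsogenous W W' ∧ 3 ^ 2 ∣ W'.torsionOrder) →
      (IsIsogenous W (⟨1, -1, 1, 1, -1⟩ : WeierstrassCurve ℚ) ∨
        IsIsogenous W (⟨1, -1, 1, -24407, -1468369⟩ : WeierstrassCurve ℚ) ∨
        IsIsogenous W (⟨1, -1, 1, -5862644, -3527169193⟩ : WeierstrassCurve ℚ)) →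
        MissingUpperBoundAt W 3 := by
  intro W _ _ _ hr _ _ _ hcls
  have hr1 : W.analyticRank ≤ 1 := by rw [hr]; exact zero_le_one
  rcases hcls with h | h | h
  · exact (lower_and_upper_of_missingPPartAt W 3 (missingPPart_of_isIsogenous_54b1 hS31 hCassels hGZK hmod 3 W hr1 h)).2
  · exact (lower_and_upper_of_missingPPartAt W 3
      (missingPPart_of_isIsogenous_1890r1 hS31 hCassels hGZK hmod 3 W hr1 h)).2
  · have h3 := missingPPart3_of_isIsogenous_122094bl1 hCassels hGZK hmod hs hSha W hr1 h
    exact (lower_and_upper_of_missingPPartAt W 3 h3).2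

end Summit.BirchSwinnertonDyer.BirchSwinnertonDyer.Theorems.WildUpperReducibleNineTorsionRecords

end
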